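import Summits.ValiantsHypothesis.ValiantsHypothesis.Theorems.KPlusLogSqLawTropicalGradedWalkSigns

/-!
# Route «KPlusLogSqLaw» — GRW-lite (all-`m` `K = 4` family): term signs at the phase boundary

HONEST FRAMING.  Helper file of the chain `--supports` the crux `Summit.ValiantsHypothesis.ValiantsHypothesis.Theses.KPlusLogSqLaw.TropicalB`
(item `stmt-ValiantsHypothesis-19771`, route `KPlusLogSqLaw`; cell `pub-symmetroid`, seat val-sym-trop-p3 g15), second sign file on top of
`…TropicalGradedWalkSigns.lean`.  Census-side (lower bound) construction for `TropRootLawAt (n+1) 4`; nothing here bears on `TropicalB`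
in its window, `WeakLifting`, `MatrixDescartes` or `VP ≠ VNP`.

CONTENT.  The last in-phase transition `X(w,w−1,1) → T(w,w,0)` (`termSign_X_T`), and the PHASE BOUNDARY: at `T(w,w,w) → D(w+1,0,0)` (`1 ≤ w`, `w + 1 ≤ n`) every column moves; the column-wise product of the
two sign patterns is: `1` at `b = 0`, `−(−1)^b` on `1 ≤ b < w`, `zsign w · (−1)^{n w}` at `b = w`, `zsign (w+1)` at `b = w + 1`
and `1` beyond (`boundary_column`); the rotation signs contribute `(−1)^n` (`sign_rot_mul_sign_rot_succ`) and the design's phase parity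
satisfies `zsign w · zsign (w+1) = (−1)^{zstep w}`, `zstep w = (n+1) + w + 1 + n w + Σ_{i<w} i` — exactly what makes the total `−1`
(`termSign_boundary`).
-/

set_option linter.dupNamespace false
set_option autoImplicit false
-- the `Fin.val_mk` clean-up before `omega` is uniform; where projection reduction already fired it is unused
set_option linter.unusedSimpArgs false

namespace Summit.ValiantsHypothesis.ValiantsHypothesis.Theorems.LacunarySymmetroidMatrixDescartes.TropicalCensus

namespace GradedWalk

open Summit.ValiantsHypothesis.ValiantsHypothesis.Theorems.MatrixDescartes.Negative

variable (n : ℕ)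

/-- `X(w,w−1,1) → T(w,w,0)` (`3 ≤ w ≤ n`): rows of the columns `w − 2`, `w − 1` exchanged back, column `w − 1` now class `2`. -/
theorem termSign_X_T (w : ℕ) (hw3 : 3 ≤ w) (hwn : w ≤ n) :
    termSign (ee n) (cterm n w (w - 1) 1) * termSign (ee n) (cterm n w w 0) < 0 := by
  have hw1 : w ≤ n + 1 := by omega
  have huw' : w - 1 < w := by omega
  rw [mul_comm]
  unfold cterm
  rw [perm_T, termSign_mul_termSign, sign_perm_X n huw' hw1 (by omega), mul_neg, ShiftThree.sign_mul_self]
  have hc12 : (⟨w - 1 - 1, by omega⟩ : Fin (n + 1)) ≠ ⟨w - 1, by omega⟩ := by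
    intro h; have := congrArg Fin.val h; simp only [Fin.val_mk] at this; omega
  rw [Finset.prod_eq_mul _ _ hc12]
  · have hl1 : lam n w w 0 ⟨w - 1 - 1, by omega⟩ = 2 := by
      rw [lam_T, if_neg (by simp only [Fin.val_mk]; omega), if_neg (Nat.not_lt_zero _)]
    have hl2 : lam n w w 0 ⟨w - 1, by omega⟩ = 2 := by
      rw [lam_T, if_neg (by simp only [Fin.val_mk]; omega), if_neg (Nat.not_lt_zero _)]
    have h := exchange_columns n w (w - 1) (by omega) huw' hwn (lam n w w 0) hl1 (Or.inr hl2)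
    rw [h]; norm_num
  · intro b _ hb
    obtain ⟨hb1, hb2⟩ := hb
    have hb1' : (b : ℕ) + 1 ≠ w - 1 := fun h => hb1 (Fin.ext (by simp only [Fin.val_mk]; omega))
    have hb2' : (b : ℕ) ≠ w - 1 := fun h => hb2 (Fin.ext (by simp only [Fin.val_mk]; omega))
    have hlam : lam n w (w - 1) 1 b = lam n w w 0 b := by
      rw [lam_X_eq_lam_D n huw' b hb1' hb2', lam_D n huw', lam_T]
      by_cases h3 : w ≤ (b : ℕ)
      · rw [if_pos h3, if_pos h3]
      · rw [if_neg h3, if_neg h3, if_pos (by omega), if_neg (Nat.not_lt_zero _)]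
    rw [perm_X_eq_rot n huw' hwn (by omega) b hb1' hb2', hlam]
    refine ee_mul_self n ?_
    rw [lam_T]
    by_cases h1 : w ≤ (b : ℕ)
    · rw [if_pos h1]
      have hr := rot_val_wrap n hw1 b h1
      exact ee_upper_zero_ne n (show ((rot n w b : Fin (n + 1)) : ℕ) < (b : ℕ) by rw [hr]; omega)
    · rw [if_neg h1, if_neg (Nat.not_lt_zero _)]
      have hr := rot_val_blk n hw1 b (by omega)
      exact ee_lower_ne n (show (b : ℕ) < ((rot n w b : Fin (n + 1)) : ℕ) by rw [hr]; omega) 2 (by decide)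
  · intro h; exact absurd (Finset.mem_univ _) h
  · intro h; exact absurd (Finset.mem_univ _) h

/-! ### the phase boundary `T(w,w,w) → D(w+1,0,0)` -/

/-- `∏_{i<w} (column product at 1 ≤ i < w) = (−1)^{Σ_{i<w} i + (w − 1)}` for `w ≥ 1`. -/
theorem prod_bdh (k : ℕ) :
    ∏ i ∈ Finset.range (k + 1), (if i = 0 then (1 : ℤ) else -((-1) ^ i)) = (-1) ^ (∑ i ∈ Finset.range (k + 1), i + k) := by
  induction k with
  | zero => simp
  | succ k ih =>
    rw [Finset.prod_range_succ, ih, Finset.sum_range_succ _ (k + 1)]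
    rw [if_neg (by omega)]
    rw [show ∑ x ∈ Finset.range (k + 1), x + (k + 1) + (k + 1) = (∑ x ∈ Finset.range (k + 1), x + k) + (k + 1) + 1 by ring,
      pow_add, pow_add, pow_one]
    ring

/-- the signs of two consecutive phase rotations multiply to `(−1)^n`. -/
theorem sign_rot_mul_sign_rot_succ (w : ℕ) (hw : w ≤ n) :
    ((Equiv.Perm.sign (rot n w) : ℤˣ) : ℤ) * ((Equiv.Perm.sign (rot n (w + 1)) : ℤˣ) : ℤ) = (-1) ^ n := by
  have h : rot n w = rot n (w + 1) * finRotate (n + 1) := by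
    unfold rot
    rw [show n + 1 - w = (n + 1 - (w + 1)) + 1 by omega, pow_succ]
  rw [h, Equiv.Perm.sign_mul, Units.val_mul, sign_finRotate, Nat.add_sub_cancel]
  rw [mul_comm, ← mul_assoc, ShiftThree.sign_mul_self, one_mul, Units.val_pow_eq_pow_val, Units.val_neg, Units.val_one]

/-- `zsign w · zsign (w+1) = (−1)^{zstep w}`. -/
theorem zsign_mul_zsign_succ (w : ℕ) : zsign n w * zsign n (w + 1) = (-1) ^ (zstep n w) := by
  unfold zsign
  rw [← pow_add, show zsum n (w + 1) = zsum n w + zstep n w from rfl,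
    show zsum n (n + 1) + zsum n w + (zsum n (n + 1) + (zsum n w + zstep n w)) =
      2 * (zsum n (n + 1) + zsum n w) + zstep n w by ring, pow_add, pow_mul]
  norm_num

/-- `zstep w = (n+1) + w + 1 + n w + Σ_{i<w} i` for `w ≥ 1`. -/
theorem zstep_eq (w : ℕ) (hw : 1 ≤ w) : zstep n w = (n + 1) + w + 1 + n * w + ∑ i ∈ Finset.range w, i := by
  unfold zstep
  rw [if_pos hw]
  have h := Finset.sum_range_id_mul_two w
  have h2 : w * (w - 1) / 2 = ∑ i ∈ Finset.range w, i := by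
    rw [← h, Nat.mul_div_cancel _ (by norm_num)]
  rw [h2]

/-- the column-wise products at the phase boundary. -/
theorem boundary_column (w : ℕ) (hw1 : 1 ≤ w) (hwn : w + 1 ≤ n) (b : Fin (n + 1)) :
    ee n (rot n w b) b (lam n w w w b) * ee n (rot n (w + 1) b) b (lam n (w + 1) 0 0 b) =
      (if (b : ℕ) = 0 then (1 : ℤ) else if (b : ℕ) < w then -((-1) ^ (b : ℕ)) else if (b : ℕ) = w then zsign n w * (-1) ^ (n * w)
      else if (b : ℕ) = w + 1 then zsign n (w + 1) else 1) := by
  have hw' : w ≤ n + 1 := by omega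
  have hw'' : w + 1 ≤ n + 1 := by omega
  rw [lam_T, lam_D n (show 0 < w + 1 by omega)]
  rcases Nat.lt_or_ge (b : ℕ) w with hbw | hbw
  · -- block columns of both phases
    have hr1 := rot_val_blk n hw' b hbw
    have hr2 := rot_val_blk n hw'' b (by omega)
    have hl1 : (b : ℕ) < ((rot n w b : Fin (n + 1)) : ℕ) := by rw [hr1]; omega
    have hl2 : (b : ℕ) < ((rot n (w + 1) b : Fin (n + 1)) : ℕ) := by rw [hr2]; omega
    rw [if_neg (by omega), if_pos hbw, if_neg (by omega), if_neg (Nat.not_lt_zero _), ee_low_three n hl1, ee_low_one n hl2,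
      hr1, hr2]
    by_cases hb0 : (b : ℕ) = 0
    · rw [if_pos hb0, if_pos hb0, hb0]; simp
    · rw [if_neg hb0, if_neg hb0, if_pos hbw]
      have he : ((b : ℕ) + (n + 1 - w)) * (b : ℕ) + ((b : ℕ) + (n + 1 - (w + 1))) * (b : ℕ) =
          2 * (((b : ℕ) + (n - w)) * (b : ℕ)) + (b : ℕ) := by
        rw [show n + 1 - w = (n - w) + 1 by omega, show n + 1 - (w + 1) = n - w by omega]; ring
      rw [mul_one, neg_mul, ← pow_add, he, pow_add, pow_mul]
      norm_num
  · rw [if_pos hbw]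
    have hr1 := rot_val_wrap n hw' b hbw
    have hup1 : ((rot n w b : Fin (n + 1)) : ℕ) < (b : ℕ) := by rw [hr1]; omega
    rw [ee_up_zero n hup1, hr1, if_neg (show ¬ ((b : ℕ) = 0) by omega), if_neg (show ¬ ((b : ℕ) < w) by omega)]
    rcases Nat.lt_or_ge (b : ℕ) (w + 1) with hb1 | hb1
    · -- `b = w`
      have hbw' : (b : ℕ) = w := by omega
      have hr2 := rot_val_blk n hw'' b hb1
      have hl2 : (b : ℕ) < ((rot n (w + 1) b : Fin (n + 1)) : ℕ) := by rw [hr2]; omega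
      rw [if_neg (show ¬ (w + 1 ≤ (b : ℕ)) by omega), if_neg (Nat.not_lt_zero _), ee_low_one n hl2, hr2,
        if_pos (show (b : ℕ) - w = 0 by omega), if_pos hbw', hbw', show w + (n + 1 - (w + 1)) = n by omega]
    · have hr2 := rot_val_wrap n hw'' b hb1
      have hup2 : ((rot n (w + 1) b : Fin (n + 1)) : ℕ) < (b : ℕ) := by rw [hr2]; omega
      rw [if_pos hb1, ee_up_zero n hup2, hr2, if_neg (show ¬ ((b : ℕ) - w = 0) by omega),
        if_neg (show ¬ ((b : ℕ) = w) by omega)]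
      rcases Nat.lt_or_ge (b : ℕ) (w + 2) with hb2 | hb2
      · have hbw' : (b : ℕ) = w + 1 := by omega
        rw [if_pos (show (b : ℕ) - (w + 1) = 0 by omega), if_pos hbw', hbw', one_mul]
      · rw [if_neg (show ¬ ((b : ℕ) - (w + 1) = 0) by omega), if_neg (show ¬ ((b : ℕ) = w + 1) by omega), one_mul]

/-- **the phase boundary**: the terms of `T(w,w,w)` and `D(w+1,0,0)` have opposite signs (`1 ≤ w`, `w + 1 ≤ n`). -/
theorem termSign_boundary (w : ℕ) (hw1 : 1 ≤ w) (hwn : w + 1 ≤ n) :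
    termSign (ee n) (cterm n w w w) * termSign (ee n) (cterm n (w + 1) 0 0) < 0 := by
  obtain ⟨k, rfl⟩ : ∃ k, w = k + 1 := ⟨w - 1, by omega⟩
  unfold cterm
  rw [perm_T, perm_D n (show 0 ≠ k + 1 + 1 by omega), termSign_mul_termSign, sign_rot_mul_sign_rot_succ n (k + 1) (by omega)]
  rw [Finset.prod_congr rfl (fun b _ => boundary_column n (k + 1) hw1 hwn b)]
  rw [Fin.prod_univ_eq_prod_range (fun i => if i = 0 then (1 : ℤ) else if i < k + 1 then -((-1) ^ i)
      else if i = k + 1 then zsign n (k + 1) * (-1) ^ (n * (k + 1)) else if i = k + 1 + 1 then zsign n (k + 1 + 1) else 1) (n + 1)]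
  rw [← Finset.prod_range_mul_prod_Ico _ (show k + 1 + 2 ≤ n + 1 by omega), Finset.prod_range_succ, Finset.prod_range_succ]
  have htail : ∏ i ∈ Finset.Ico (k + 1 + 2) (n + 1), (if i = 0 then (1 : ℤ) else if i < k + 1 then -((-1) ^ i)
      else if i = k + 1 then zsign n (k + 1) * (-1) ^ (n * (k + 1)) else if i = k + 1 + 1 then zsign n (k + 1 + 1) else 1) = 1 := by
    refine Finset.prod_eq_one fun i hi => ?_
    rw [Finset.mem_Ico] at hi
    rw [if_neg (by omega), if_neg (by omega), if_neg (by omega), if_neg (by omega)]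
  have hhead : ∏ i ∈ Finset.range (k + 1), (if i = 0 then (1 : ℤ) else if i < k + 1 then -((-1) ^ i)
      else if i = k + 1 then zsign n (k + 1) * (-1) ^ (n * (k + 1)) else if i = k + 1 + 1 then zsign n (k + 1 + 1) else 1) =
      ∏ i ∈ Finset.range (k + 1), (if i = 0 then (1 : ℤ) else -((-1) ^ i)) := by
    refine Finset.prod_congr rfl fun i hi => ?_
    rw [Finset.mem_range] at hi
    by_cases hi0 : i = 0
    · rw [if_pos hi0, if_pos hi0]
    · rw [if_neg hi0, if_neg hi0, if_pos hi]
  rw [htail, hhead, prod_bdh, mul_one, if_neg (show k + 1 ≠ 0 by omega), if_neg (lt_irrefl _), if_pos rfl,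
    if_neg (show k + 1 + 1 ≠ 0 by omega), if_neg (show ¬ (k + 1 + 1 < k + 1) by omega), if_neg (show k + 1 + 1 ≠ k + 1 by omega),
    if_pos rfl]
  set S := ∑ i ∈ Finset.range (k + 1), i with hS
  have hz := zsign_mul_zsign_succ n (k + 1)
  rw [zstep_eq n (k + 1) hw1, ← hS] at hz
  have hfin : (-1 : ℤ) ^ n * ((-1) ^ (S + k) * (zsign n (k + 1) * (-1) ^ (n * (k + 1))) * zsign n (k + 1 + 1)) =
      (-1) ^ n * (-1) ^ (S + k) * (-1) ^ (n * (k + 1)) * (zsign n (k + 1) * zsign n (k + 1 + 1)) := by ring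
  rw [hfin, hz, ← pow_add, ← pow_add, ← pow_add,
    show n + (S + k) + n * (k + 1) + (n + 1 + (k + 1) + 1 + n * (k + 1) + S) = 2 * (n + S + k + n * (k + 1) + 1) + 1 by ring]
  rw [Odd.neg_one_pow ⟨_, rfl⟩]
  norm_num

end GradedWalk

end Summit.ValiantsHypothesis.ValiantsHypothesis.Theorems.LacunarySymmetroidMatrixDescartes.TropicalCensus
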